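import Mathlib

/-!
# Crux `BrascampLiebVacuum` (stmt-QuantumFields-8779), line `per-scale-brascamp-lieb` — stub `stub_condVarTelescope`

Orthogonality of martingale differences (law of total variance, twice).
-/

open scoped BigOperators Topology
open Filter MeasureTheory

noncomputable section

namespace Summit.QuantumFields.YangMills.Theorems.BrascampLiebVacuum

/-- **Stub (MATHEMATICS — orthogonality of martingale differences / law of total variance, twice).**
For a probability measure `μ`, sub-σ-algebras `m₂ ≤ m₁ ≤ m0` and `f ∈ L²(μ)`:
`Var f = E(f − E[f|m₁])² + E(E[f|m₁] − E[f|m₂])² + E(E[f|m₂] − E f)²`. [folklore] -/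
theorem stub_condVarTelescope {Ω : Type*} {m0 : MeasurableSpace Ω} (μ : Measure Ω)
    [IsProbabilityMeasure μ] (m₁ m₂ : MeasurableSpace Ω) (hm₁ : m₁ ≤ m0) (hm₂₁ : m₂ ≤ m₁)
    (f : Ω → ℝ) (hf : MemLp f 2 μ) :
    ∫ ω, (f ω - ∫ ω', f ω' ∂μ) ^ 2 ∂μ =
      ∫ ω, (f ω - (μ[f|m₁]) ω) ^ 2 ∂μ + ∫ ω, ((μ[f|m₁]) ω - (μ[f|m₂]) ω) ^ 2 ∂μ +
        ∫ ω, ((μ[f|m₂]) ω - ∫ ω', f ω' ∂μ) ^ 2 ∂μ := by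
  have hm₂ : m₂ ≤ m0 := hm₂₁.trans hm₁
  have hf₁ : MemLp (μ[f|m₁]) 2 μ := hf.condExp one_le_two
  -- law of total variance, twice
  have h1 := ProbabilityTheory.integral_condVar_add_variance_condExp hm₁ hf
  have h2 := ProbabilityTheory.integral_condVar_add_variance_condExp (μ := μ) hm₂ hf₁
  -- tower property
  have htower : μ[μ[f|m₁]|m₂] =ᵐ[μ] μ[f|m₂] := condExp_condExp_of_le hm₂₁ hm₁
  have hA : ∫ ω, (ProbabilityTheory.condVar m₁ f μ) ω ∂μ =
      ∫ ω, (f ω - (μ[f|m₁]) ω) ^ 2 ∂μ := by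
    rw [ProbabilityTheory.condVar, integral_condExp hm₁]
    rfl
  have hB : ∫ ω, (ProbabilityTheory.condVar m₂ (μ[f|m₁]) μ) ω ∂μ =
      ∫ ω, ((μ[f|m₁]) ω - (μ[f|m₂]) ω) ^ 2 ∂μ := by
    rw [ProbabilityTheory.condVar, integral_condExp hm₂]
    refine integral_congr_ae ?_
    filter_upwards [htower] with ω hω
    simp [hω]
  have hC : ProbabilityTheory.variance (μ[μ[f|m₁]|m₂]) μ =
      ∫ ω, ((μ[f|m₂]) ω - ∫ ω', f ω' ∂μ) ^ 2 ∂μ := by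
    rw [ProbabilityTheory.variance_congr htower,
      ProbabilityTheory.variance_eq_integral
        (integrable_condExp (m := m₂) (μ := μ) (f := f)).aestronglyMeasurable.aemeasurable,
      integral_condExp hm₂]
  have hD : ProbabilityTheory.variance f μ = ∫ ω, (f ω - ∫ ω', f ω' ∂μ) ^ 2 ∂μ :=
    ProbabilityTheory.variance_eq_integral hf.aestronglyMeasurable.aemeasurable
  have hE : ProbabilityTheory.variance (μ[f|m₁]) μ =
      ∫ ω, (ProbabilityTheory.condVar m₂ (μ[f|m₁]) μ) ω ∂μ +
        ProbabilityTheory.variance (μ[μ[f|m₁]|m₂]) μ := h2.symm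
  rw [← hD, ← h1, hA, hE, hB, hC, add_assoc]


end Summit.QuantumFields.YangMills.Theorems.BrascampLiebVacuum

end
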